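import Mathlib
import Summits.ResolutionOfSingularities.ResolutionOfSingularities.Theorems.PAlterationAssemblyReduction
import Summits.ResolutionOfSingularities.ResolutionOfSingularities.Theorems.PAlterationAssembly2
import Summits.ResolutionOfSingularities.ResolutionOfSingularities.Theorems.PAlterationPicoverToRadicialBottomReducedPullback
import Summits.ResolutionOfSingularities.ResolutionOfSingularities.Theorems.DescentDescentPerfectToAllRobustModel
import Literature.AlgebraicGeometry.Resolution.QuasiProjectiveResolution
import Literature.AlgebraicGeometry.Resolution.PrincipalizationToResolution

/-!
# `PAlteration.PicoverToRadicialBottom` (stmt-ResolutionOfSingularities-0556): the twisted resolution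

Route `ResolutionOfSingularities/pAlteration`, crux `PicoverToRadicialBottom`
(stmt-ResolutionOfSingularities-0556), line `theta-finite-cofinite-roots`, stub
`stub_twistedResolution` of the lead's skeleton `work/PicoverToRadicialBottom.lean`, PROVED here
(statement verbatim from the registration).

**Statement.** `k` a field of characteristic `p`, `L ⊇ k` a field extension with
`L^{p^r} ⊆ k` (purely inseparable of bounded exponent), `X''` an integral scheme of finite type
over `k`, `π : Z → X''` proper birational with `Z_L := Z ×_k L` regular. Then `Z_L` is integral
and admits a proper birational morphism to the reduced base change `(X'' ×_k L)_red`.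

**Proof.** `j : Spec L → Spec k` is flat, integral, universally injective and surjective (a
universal homeomorphism). The base change `ρ₀ : Z_L → X''_L` of `π` along the flat projection
`X''_L → X''` is proper and birational (`isBirational_of_isPullback_of_flat`: `X''`, `Z` are
Noetherian). `Z_L` is reduced (regular), so `ρ₀` factors as `ρ ≫ ι` through the reduced closed
subscheme `ι : (X''_L)_red → X''_L`; `ρ` is proper (`ι` separated) and birational: over the
preimage `ι⁻¹ U` of an open `U` over which `ρ₀` is an isomorphism, `ρ ∣ ι⁻¹U ≫ ι ∣ U = ρ₀ ∣ U`
with `ι ∣ U` an isomorphism because `U ≅ ρ₀⁻¹ U` is reduced. Finally `Z_L → Z` is a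
homeomorphism (base change of `j`) and `Z` is irreducible (birational over the integral `X''`),
so `Z_L` is irreducible and reduced, i.e. integral.
-/

noncomputable section

-- single-problem summit: the doubled namespace component `ResolutionOfSingularities` is forced
set_option linter.dupNamespace false

open CategoryTheory CategoryTheory.Limits AlgebraicGeometry TopologicalSpace Opposite
open Literature.AlgebraicGeometry.Resolution
open Scheme.IdealSheafData

namespace Summit.ResolutionOfSingularities.ResolutionOfSingularities.Theorems

/-- A morphism `ρ : Y ⟶ T_red` from a reduced scheme whose composite with the inclusion
`ι : T_red ⟶ T` of the reduced closed subscheme is birational is itself birational: over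
`ι⁻¹ U`, where `ρ ≫ ι` is an isomorphism over the dense open `U`, one has
`ρ ∣ ι⁻¹U ≫ ι ∣ U = (ρ ≫ ι) ∣ U`, and `ι ∣ U` is an isomorphism since `U ≅ (ρ ≫ ι)⁻¹ U` is
reduced. [folklore] -/
theorem isBirational_of_comp_subschemeι_vanishingIdeal_top {Y T : Scheme.{0}} [IsReduced Y]
    (ρ : Y ⟶ (vanishingIdeal (⊤ : Closeds T)).subscheme)
    (h : IsBirational (ρ ≫ (vanishingIdeal (⊤ : Closeds T)).subschemeι)) : IsBirational ρ := by
  obtain ⟨U, hU, hU', hiso⟩ := h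
  refine ⟨(vanishingIdeal (⊤ : Closeds T)).subschemeι ⁻¹ᵁ U, ?_, ?_, ?_⟩
  · exact hU.preimage (isHomeomorph_subschemeι_vanishingIdeal_top (T := T)).isOpenMap
  · rwa [← Scheme.Hom.comp_preimage]
  · -- `U` is reduced: it is isomorphic to the open `(ρ ≫ ι)⁻¹ U` of the reduced scheme `Y`
    haveI : IsReduced (U : Scheme.{0}) :=
      isReduced_of_isOpenImmersion (inv ((ρ ≫ (vanishingIdeal (⊤ : Closeds T)).subschemeι) ∣_ U))
    haveI : IsIso ((vanishingIdeal (⊤ : Closeds T)).subschemeι ∣_ U) :=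
      isIso_subschemeι_vanishingIdeal_top_morphismRestrict U
    have h2 : IsIso (ρ ∣_ ((vanishingIdeal (⊤ : Closeds T)).subschemeι ⁻¹ᵁ U) ≫
        (vanishingIdeal (⊤ : Closeds T)).subschemeι ∣_ U) := by
      rwa [← morphismRestrict_comp]
    exact IsIso.of_isIso_comp_right (ρ ∣_ ((vanishingIdeal (⊤ : Closeds T)).subschemeι ⁻¹ᵁ U))
      ((vanishingIdeal (⊤ : Closeds T)).subschemeι ∣_ U)

/-- **S4 (twisted resolution).** For `L/k` purely inseparable of bounded exponent and a proper
birational `π : Z ⟶ X''` whose base change `Z_L` is regular, `Z_L` is integral and resolves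
`(X'' ⊗_k L)_red`. [folklore] -/
theorem stub_twistedResolution : ∀ (p : ℕ) [Fact p.Prime] (k : Type) [Field k] [CharP k p]
    (L : Type) [Field L] [Algebra k L] (r : ℕ), (∀ x : L, x ^ p ^ r ∈ (algebraMap k L).range) →
    ∀ (X'' Z : Scheme.{0}) [IsIntegral X''] (f'' : X'' ⟶ Spec (.of k)) [LocallyOfFiniteType f'']
    [QuasiCompact f''] (π : Z ⟶ X'') [IsProper π], IsBirational π →
    Scheme.IsRegular (pullback (π ≫ f'') (Spec.map (CommRingCat.ofHom (algebraMap k L)))) →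
    IsIntegral (pullback (π ≫ f'') (Spec.map (CommRingCat.ofHom (algebraMap k L)))) ∧
    ∃ ρ : pullback (π ≫ f'') (Spec.map (CommRingCat.ofHom (algebraMap k L))) ⟶
      (vanishingIdeal (⊤ : Closeds
        ↑(pullback f'' (Spec.map (CommRingCat.ofHom (algebraMap k L)))))).subscheme,
      IsProper ρ ∧ IsBirational ρ := by
  intro p _ k _ _ L _ _ r hexp X'' Z _ f'' _ _ π _ hbir hreg
  -- the universal homeomorphism `j : Spec L → Spec k`: flat, integral, universally injective
  set j : Spec (.of L) ⟶ Spec (.of k) := Spec.map (CommRingCat.ofHom (algebraMap k L)) with hj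
  haveI : Flat j := flat_SpecMap_algebraMap_of_field k L
  haveI : Algebra.IsIntegral k L := ⟨fun x => by
    obtain ⟨a, ha⟩ := RingHom.mem_range.mp (hexp x)
    refine IsIntegral.of_pow (pow_pos (Fact.out : p.Prime).pos r) ?_
    rw [← ha]
    exact isIntegral_algebraMap⟩
  haveI : IsIntegralHom j := isIntegralHom_SpecMap_algebraMap_of_isAlgebraic k L
  haveI : UniversallyInjective j :=
    universallyInjective_specMap_of_pow_mem (algebraMap k L) p
      fun c => ⟨r, RingHom.mem_range.mp (hexp c)⟩
  -- `X''` and `Z` are of finite type over `k`, hence Noetherian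
  haveI : IsNoetherian X'' := Scheme.isNoetherian_of_finiteType_over_field f''
  haveI : IsNoetherian Z := Scheme.isNoetherian_of_finiteType_over_field (π ≫ f'')
  -- the base change `ρ₀ : Z_L → X''_L` of `π` along the flat projection `X''_L → X''`
  obtain ⟨ρ₀, h₁, h₂⟩ :
      ∃ ρ₀ : pullback (π ≫ f'') j ⟶ pullback f'' j,
        pullback.fst (π ≫ f'') j ≫ π = ρ₀ ≫ pullback.fst f'' j ∧
        ρ₀ ≫ pullback.snd f'' j = pullback.snd (π ≫ f'') j :=
    ⟨pullback.lift (pullback.fst _ _ ≫ π) (pullback.snd _ _)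
      (by rw [Category.assoc, pullback.condition]),
      (pullback.lift_fst _ _ _).symm, pullback.lift_snd _ _ _⟩
  have big := IsPullback.of_hasPullback (π ≫ f'') j
  rw [← h₂] at big
  have sq : IsPullback (pullback.fst (π ≫ f'') j) ρ₀ π (pullback.fst f'' j) :=
    IsPullback.of_bot big h₁ (IsPullback.of_hasPullback f'' j)
  haveI : IsProper ρ₀ := MorphismProperty.of_isPullback sq ‹IsProper π›
  have hbir₀ : IsBirational ρ₀ := isBirational_of_isPullback_of_flat sq hbir
  -- `Z_L` is integral: reduced (regular) and irreducible (homeomorphic to the irreducible `Z`)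
  haveI : IsReduced (pullback (π ≫ f'') j) := hreg.isReduced
  haveI : IrreducibleSpace Z := hbir.irreducibleSpace
  haveI : UniversallyInjective (pullback.fst (π ≫ f'') j) :=
    MorphismProperty.pullback_fst (P := @UniversallyInjective) _ _ ‹_›
  haveI : IrreducibleSpace ↑(pullback (π ≫ f'') j) :=
    (isHomeomorph_of_isIntegralHom_of_universallyInjective_of_surjective
      (pullback.fst (π ≫ f'') j)).homeomorph.irreducibleSpace_iff.mpr ‹_›
  have hint : IsIntegral (pullback (π ≫ f'') j) := isIntegral_of_irreducibleSpace_of_isReduced _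
  -- factor `ρ₀` through the reduced closed subscheme of `X''_L`
  obtain ⟨ρ, hρ⟩ := exists_lift_reduced ρ₀
  subst hρ
  exact ⟨hint, ρ, IsProper.of_comp ρ (vanishingIdeal (⊤ : Closeds ↑(pullback f'' j))).subschemeι,
    isBirational_of_comp_subschemeι_vanishingIdeal_top ρ hbir₀⟩

end Summit.ResolutionOfSingularities.ResolutionOfSingularities.Theorems

end
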